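import Summits.FinalStateConjecture.FinalStateConjecture.Theorems.SoloInformedCombGenericity

/-!
# SoloInformed — outcome interfaces along admissible curves meet the exceptional set

Soloist `solo-FinalStateConjecture-informed` (session 8, 2026-08-19). Kernel facts about the QUANTIFIER
SHAPE of the summit `FinalStateConjecture`, companion to `SoloInformedCombGenericity.lean`
(`censorshipExceptional`, `settlingExceptional`, `exceptional_eq_union`); the only mathematics used is
the connectedness of a real interval.

1. `exists_mem_Ioo_notMem_union_of_isOpen_preimage` (pure topology): if a map `F : ℝ → α` has OPEN
   preimages of two DISJOINT sets `A`, `B` and `F a ∈ A`, `F b ∈ B`, `a ≤ b`, then some parameter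
   `c ∈ (a, b)` has `F c ∉ A ∪ B` (`isPreconnected_Icc`).
2. `holeCountClass X N`: admissible vacuum data having a maximal vacuum Cauchy development whose
   exterior carries a typed `C²` final state decomposition (`FinalStateDecomposition`, sub-extremal,
   exterior = `exteriorOf`, rays stay in the closure, exhaustive future-oriented charts — the summit's
   settling clauses verbatim) with exactly `N` black holes; `good_subset_iUnion_holeCountClass`: every
   admissible datum outside `𝓔_W ∪ 𝓔_S` lies in some `holeCountClass X N` (the summit's pointwise
   property asserts an MGHD exists and every MGHD settles; take `N := d.N`).
3. `exists_mem_Ioo_exceptional_of_interface` (**interface principle**): along any curve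
   `F : ℝ → InitialDataSet (𝓡 3) X` with `F [a, b] ⊆ admissibleVacuumData X`, if two disjoint OUTCOME
   classes `A ∋ F a`, `B ∋ F b` have open preimages and every GOOD datum on the segment lies in `A ∪ B`,
   then the segment contains an exceptional datum `F c ∈ 𝓔_W ∪ 𝓔_S`, `a < c < b`.
4. `exists_mem_Ioo_exceptional_of_dispersion_collapse`: the instance `A = holeCountClass X 0`
   (dispersion), `B = T` any class containing every `holeCountClass X N`, `N ≥ 1`, and disjoint from
   `holeCountClass X 0` (intended: data whose MGHDs contain a closed trapped surface), both with open
   preimage along `F`: every admissible curve from dispersing data to `T`-data passes through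
   `𝓔_W ∪ 𝓔_S`. `finalStateConjecture_escape_at_interface`: under the summit, through that critical
   datum passes a tame escaping family (the summit's witness, verbatim).

Why this is recorded (paper/SHARPEST.md §(G6)). The hypotheses of 4 are the expected theorems
"robust dispersion is open along smooth families" (nonlinear stability of Minkowski space with a
quantitative smallness condition continuous along `C^∞` families) and "existence of a closed trapped
surface in the MGHD is open along smooth families" (Cauchy stability), plus "`N ≥ 1` settling exteriors
have trapped surfaces behind them" and "a trapped surface is incompatible with `N = 0` settling with
complete `𝓘⁺`" (Penrose-type). Granting them, the exceptional set of the summit is NON-EMPTY on every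
`Σ` carrying an admissible curve from dispersing to trapped data, and contains the whole
critical-collapse THRESHOLD met by every such curve: the summit's tame-codimension-one witness must be
produced AT critical data, and (by `not_union_subset_escapable` in `SoloInformedCombGenericity.lean`)
the threshold set must not accumulate on itself from both sides along the escaping direction. By
contrast the binary "immediate merger" threshold is not an outcome interface of the typed statement
(both sides have `N = 1` eventually: Pretorius–Khurana, CQG 24 (2007) S83, p. 5 and §5.1;
Gundlach–Akcay–Barack–Nagar, PRD 86 (2012) 084022, §VI), and the bound/unbound interface of two holes
carries typed-GOOD marginal data at which `holeCountClass X 2` is not open along curves, so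
"capture by open outcome basins" cannot be the whole mechanism of a proof.

References: [Christodoulou1999] p. A24; [DafermosLuk2017] §1.2.1; Choptuik, PRL 70 (1993) 9;
Pretorius–Khurana arXiv:gr-qc/0702084; Gundlach–Akcay–Barack–Nagar arXiv:1207.5167;
Baumgarte et al. arXiv:2305.17171; Szybka–Chmaj arXiv:0711.4612.
-/

open Literature.Geometry.Lorentzian
open scoped Manifold ContDiff Topology
open Filter Set

set_option linter.dupNamespace false

namespace Summit.FinalStateConjecture.FinalStateConjecture.Theorems

/-! ### 1. The interval argument -/

/-- **Two disjoint open outcomes along a real one-parameter family omit a parameter in between.**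
If `F : ℝ → α` has open preimages of the disjoint sets `A ∋ F a` and `B ∋ F b`, `a ≤ b`, then
`F c ∉ A ∪ B` for some `c ∈ (a, b)`: otherwise `[a, b]` would be covered by two disjoint relatively
open non-empty sets. [folklore] -/
theorem exists_mem_Ioo_notMem_union_of_isOpen_preimage {α : Type*} (F : ℝ → α) {A B : Set α}
    (hAB : Disjoint A B) (hA : IsOpen (F ⁻¹' A)) (hB : IsOpen (F ⁻¹' B)) {a b : ℝ} (hab : a ≤ b)
    (ha : F a ∈ A) (hb : F b ∈ B) : ∃ c ∈ Ioo a b, F c ∉ A ∪ B := by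
  by_contra h
  have hcover : Icc a b ⊆ F ⁻¹' A ∪ F ⁻¹' B := by
    intro c hc
    rcases eq_or_lt_of_le hc.1 with hac | hac
    · exact Or.inl (by rw [mem_preimage, ← hac]; exact ha)
    rcases eq_or_lt_of_le hc.2 with hcb | hcb
    · exact Or.inr (by rw [mem_preimage, hcb]; exact hb)
    by_contra hn
    exact h ⟨c, ⟨hac, hcb⟩, fun hu ↦ hn ((mem_union _ _ _).mpr hu)⟩
  obtain ⟨c, -, hcA, hcB⟩ := isPreconnected_Icc _ _ hA hB hcover
    ⟨a, left_mem_Icc.mpr hab, ha⟩ ⟨b, right_mem_Icc.mpr hab, hb⟩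
  exact Set.disjoint_left.mp hAB hcA hcB

/-! ### 2. Outcome classes by number of black holes -/

section Summit

variable (X : Type) [TopologicalSpace X] [ChartedSpace E3 X] [IsManifold (𝓡 3) ∞ X] [T2Space X]
  [SecondCountableTopology X] [ConnectedSpace X]

/-- The **`N`-hole outcome class** `G_N(Σ)`: admissible vacuum data with a maximal vacuum Cauchy
development whose exterior admits the summit's typed `C²` final state decomposition (sub-extremal Kerr
parameters, exterior = `exteriorOf` the charts, rays stay in the closure, exhaustive future-oriented
charts) with exactly `N` black holes. `N = 0` is dispersion. [cite: DafermosLuk2017, §1.2.1] -/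
def holeCountClass (N : ℕ) : Set (InitialDataSet (𝓡 3) X) :=
  {D ∈ admissibleVacuumData X | ∃ 𝒟 : VacuumCauchyDevelopment D, 𝒟.IsMaximal ∧
    ∃ (O : Set 𝒟.carrier) (d : FinalStateDecomposition 𝒟.toSpacetime O 2), d.N = N ∧
      (∀ i, Kerr.IsSubextremal (d.mass i) (d.spin i)) ∧
        O = Summit.FinalStateConjecture.exteriorOf 𝒟.toCauchyDevelopment d.charted ∧
          Summit.FinalStateConjecture.RaysStayInClosure 𝒟.toCauchyDevelopment O ∧
            Summit.FinalStateConjecture.HasExhaustiveCharts d ∧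
              Summit.FinalStateConjecture.IsFutureOriented d}

omit [T2Space X] [SecondCountableTopology X] in
/-- **Good data are stratified by the number of final black holes**: an admissible datum outside
`𝓔_W ∪ 𝓔_S` lies in `holeCountClass X N` for some `N` (its asserted MGHD settles; `N` is the number of
holes of the asserted decomposition). [cite: DafermosLuk2017, §1.2.1] -/
theorem good_subset_iUnion_holeCountClass :
    admissibleVacuumData X \ (censorshipExceptional X ∪ settlingExceptional X) ⊆
      ⋃ N, holeCountClass X N := by
  rintro D ⟨hD, hgood⟩
  have hS : (∃ 𝒟 : VacuumCauchyDevelopment D, 𝒟.IsMaximal) ∧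
      ∀ 𝒟 : VacuumCauchyDevelopment D, 𝒟.IsMaximal →
        ∃ (O : Set 𝒟.carrier) (d : FinalStateDecomposition 𝒟.toSpacetime O 2),
          (∀ i, Kerr.IsSubextremal (d.mass i) (d.spin i)) ∧
            O = Summit.FinalStateConjecture.exteriorOf 𝒟.toCauchyDevelopment d.charted ∧
              Summit.FinalStateConjecture.RaysStayInClosure 𝒟.toCauchyDevelopment O ∧
                Summit.FinalStateConjecture.HasExhaustiveCharts d ∧
                  Summit.FinalStateConjecture.IsFutureOriented d := by
    by_contra hn
    exact hgood (Or.inr ⟨hD, hn⟩)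
  obtain ⟨⟨𝒟, h𝒟⟩, hall⟩ := hS
  obtain ⟨O, d, hsub, hO, hrays, hexh, hfut⟩ := hall 𝒟 h𝒟
  exact mem_iUnion.mpr ⟨d.N, hD, 𝒟, h𝒟, O, d, rfl, hsub, hO, hrays, hexh, hfut⟩

/-! ### 3. The interface principle -/

omit [T2Space X] [SecondCountableTopology X] in
/-- **Interface principle.** Let `F : ℝ → InitialDataSet (𝓡 3) X` map `[a, b]` into the admissible
class, and let `A`, `B` be disjoint outcome classes with open preimages along `F`, `F a ∈ A`, `F b ∈ B`,
such that every GOOD datum on the segment (admissible, outside `𝓔_W ∪ 𝓔_S`) lies in `A ∪ B`. Then the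
segment contains an exceptional datum: `F c ∈ 𝓔_W ∪ 𝓔_S` for some `a < c < b`.
[cite: Christodoulou1999, p. A24] -/
theorem exists_mem_Ioo_exceptional_of_interface (F : ℝ → InitialDataSet (𝓡 3) X) {a b : ℝ}
    (hab : a ≤ b) (hF : ∀ c ∈ Icc a b, F c ∈ admissibleVacuumData X)
    {A B : Set (InitialDataSet (𝓡 3) X)} (hAB : Disjoint A B) (hA : IsOpen (F ⁻¹' A))
    (hB : IsOpen (F ⁻¹' B)) (ha : F a ∈ A) (hb : F b ∈ B)
    (hgood : ∀ c ∈ Icc a b, F c ∈ admissibleVacuumData X \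
      (censorshipExceptional X ∪ settlingExceptional X) → F c ∈ A ∪ B) :
    ∃ c ∈ Ioo a b, F c ∈ censorshipExceptional X ∪ settlingExceptional X := by
  obtain ⟨c, hc, hnot⟩ := exists_mem_Ioo_notMem_union_of_isOpen_preimage F hAB hA hB hab ha hb
  refine ⟨c, hc, ?_⟩
  by_contra hE
  exact hnot (hgood c (Ioo_subset_Icc_self hc) ⟨hF c (Ioo_subset_Icc_self hc), hE⟩)

/-! ### 4. The dispersion / collapse interface -/

omit [T2Space X] [SecondCountableTopology X] in
/-- **Every admissible curve from dispersion to collapse crosses the exceptional set.** Let `T` be an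
outcome class (intended: data all of whose MGHDs contain a closed trapped surface) which contains
every `holeCountClass X N` with `N ≥ 1` and is disjoint from the dispersion class `holeCountClass X 0`,
and let `F` be a curve of admissible data on `[a, b]` along which both `holeCountClass X 0` and `T` have
open preimage, with `F a` dispersing and `F b ∈ T`. Then `F c ∈ 𝓔_W ∪ 𝓔_S` for some `a < c < b`: the
critical-collapse threshold on the curve is exceptional for the summit. [cite: Christodoulou1999, p. A24] -/
theorem exists_mem_Ioo_exceptional_of_dispersion_collapse (T : Set (InitialDataSet (𝓡 3) X))
    (hT : ∀ N, 1 ≤ N → holeCountClass X N ⊆ T) (hT0 : Disjoint (holeCountClass X 0) T)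
    (F : ℝ → InitialDataSet (𝓡 3) X) {a b : ℝ} (hab : a ≤ b)
    (hF : ∀ c ∈ Icc a b, F c ∈ admissibleVacuumData X) (h0 : IsOpen (F ⁻¹' holeCountClass X 0))
    (hTo : IsOpen (F ⁻¹' T)) (ha : F a ∈ holeCountClass X 0) (hb : F b ∈ T) :
    ∃ c ∈ Ioo a b, F c ∈ censorshipExceptional X ∪ settlingExceptional X := by
  refine exists_mem_Ioo_exceptional_of_interface X F hab hF hT0 h0 hTo ha hb fun c _ hgood ↦ ?_
  have hmem : F c ∈ ⋃ N, holeCountClass X N := good_subset_iUnion_holeCountClass X hgood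
  obtain ⟨N, hN⟩ := mem_iUnion.mp hmem
  rcases Nat.eq_zero_or_pos N with h | h
  · exact Or.inl (h ▸ hN)
  · exact Or.inr (hT N h hN)

/-- **Under the summit, the critical datum on such a curve is escapable**: if `FinalStateConjecture`
holds then, in the situation of `exists_mem_Ioo_exceptional_of_dispersion_collapse`, through some
`F c`, `a < c < b`, passes an injective one-parameter family of admissible data, tame on one end and
immersed at `F c`, all of whose other members are good (the summit's witness at `F c`, verbatim).
[cite: Christodoulou1999, p. A24] -/
theorem finalStateConjecture_escape_at_interface (hFSC : FinalStateConjecture)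
    (T : Set (InitialDataSet (𝓡 3) X)) (hT : ∀ N, 1 ≤ N → holeCountClass X N ⊆ T)
    (hT0 : Disjoint (holeCountClass X 0) T) (F : ℝ → InitialDataSet (𝓡 3) X) {a b : ℝ}
    (hab : a ≤ b) (hF : ∀ c ∈ Icc a b, F c ∈ admissibleVacuumData X)
    (h0 : IsOpen (F ⁻¹' holeCountClass X 0)) (hTo : IsOpen (F ⁻¹' T))
    (ha : F a ∈ holeCountClass X 0) (hb : F b ∈ T) :
    ∃ c ∈ Ioo a b, ∃ (e : AFEnd X) (G : EuclideanSpace ℝ (Fin 1) → InitialDataSet (𝓡 3) X),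
      InitialDataSet.IsTameDataFamily e 1 G ∧ InitialDataSet.IsImmersedAtZero 1 G ∧ G 0 = F c ∧ Function.Injective G ∧
        (∀ s, G s ∈ admissibleVacuumData X) ∧
          ∀ s ≠ 0, G s ∉ censorshipExceptional X ∪ settlingExceptional X := by
  obtain ⟨c, hc, hE⟩ :=
    exists_mem_Ioo_exceptional_of_dispersion_collapse X T hT hT0 F hab hF h0 hTo ha hb
  exact ⟨c, hc, finalStateConjecture_iff_union.mp hFSC X (F c) hE⟩

end Summit

end Summit.FinalStateConjecture.FinalStateConjecture.Theorems
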